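import Literature.Analysis.FluidPDE.LerayEnstrophyAPrioriForced
import Literature.Analysis.FluidPDE.NSForcedH1ContinuationOfLocalExistence
import Literature.Analysis.FluidPDE.LerayHopfTranslate
import Literature.Analysis.FluidPDE.TaoH1AlmostRegularForced
import HarnessLib

/-!
# Size conversions for a Clay-class force: the `L¹_t H¹_x` budget of
# `tao2011_forced_H1_local_almost_regular` in the currencies of the energy and enstrophy bounds

Analysis/FluidPDE support file (cell `pub/ns-blowup`, seat `ns-blowup-lit` g11; no definitions, no
named facts). The Literature fact `tao2011_forced_H1_local_almost_regular` (Tao 2013, Thm. 5.4) measures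
the force by the single `ℝ≥0∞` budget `∫⁻ t in Ioo 0 T, eH1NormSq (f t) ^ (2⁻¹ : ℝ) ≤ ENNReal.ofReal B`
(`‖f‖_{L¹_t H¹_x([0,T] × ℝ³)} ≤ B`). The bricks of its proof consume the force in three other
currencies; this file converts once and for all (the conversions were private in
`TaoSmoothExistenceForcedFullSlab`; they are re-issued here for the assembly file and later users):

* `lintegral_Icc_sqrt_energy_le_lintegral_Ioo_sqrt_eH1NormSq` — the energy-bound currency of
  `tao2011_forced_finiteEnergy_energyBound` (`∫⁻_{Icc 0 T'} (∫⁻ ‖f t‖ₑ²)^{1/2} ≤ ∫⁻_{Ioo 0 T} ‖f t‖_{H¹}`,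
  any `f`, `T' ≤ T`);
* `lintegral_Ioo_sqrt_eH1NormSq_timeShift_le` — the budget of the SHIFTED force `t ↦ f (t + s)` on
  `[0, T - s]` is at most the budget of `f` on `[0, T]` (restarts; any `f`, `0 ≤ s`);
* `HasUniformRapidDecayOn.continuousOn_integral_frobeniusNormSq_fderiv`,
  `HasUniformRapidDecayOn.ofReal_integral_frobeniusNormSq_fderiv_eq` — for a slab-Schwartz force,
  `t ↦ ∫ |∇f(t)|²` is continuous on `[0, T]` and its Bochner and lower integrals agree;
* `HasUniformRapidDecayOn.integral_sqrt_frobeniusNormSq_fderiv_le` — the enstrophy-bound currency of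
  `exists_leray_enstrophy_apriori_forced` (`∫ t in 0..T', √(∫ |∇f(t)|²) ≤ B`, real interval integral,
  `0 < T' ≤ T`), for a slab-Schwartz force; `clayForce_integral_sqrt_frobeniusNormSq_fderiv_le` — the
  same for a Clay-class force (`IsSmoothOnHalfSpace`, `HasRapidSpaceTimeDecay`).

All statements are elementary measure theory (monotonicity of `lintegral` in the set and the
integrand, `‖∇v‖₂ ≤ ‖v‖_{H¹}`, `‖v‖₂ ≤ ‖v‖_{H¹}`, translation invariance of Lebesgue measure).

## References
* T. Tao, Localisation and compactness properties of the Navier–Stokes global regularity problem,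
  Anal. PDE 6 (2013), Thm. 5.4 and the norm `‖f‖_{L¹_t H¹_x}` of its hypothesis (ii). [cite: Tao2011, Thm. 5.4]
* C. L. Fefferman, Existence and smoothness of the Navier–Stokes equation (Clay, 2006), (5)–(6)
  (the force class). [cite: FeffermanClay2006, (5)-(6)]
-/

noncomputable section

open MeasureTheory Set Function Filter InnerProductSpace
open _root_.Topology
open scoped ENNReal NNReal ContDiff RealInnerProductSpace

namespace Literature.Analysis.FluidPDE

variable {T : ℝ} {f : ℝ → EuclideanSpace ℝ (Fin 3) → EuclideanSpace ℝ (Fin 3)}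

/-! ### Generic conversions (any `f`) -/

/-- `∫₀^{T'} ‖f(t)‖_{L²} dt ≤ ∫₀ᵀ ‖f(t)‖_{H¹} dt` (`T' ≤ T`), in the `ℝ≥0∞` currencies of the forced
energy bound (`tao2011_forced_finiteEnergy_energyBound`) and of the `H¹` theory (`eH1NormSq`):
`‖v‖₂ ≤ ‖v‖_{H¹}` slice by slice and `Icc 0 T' =ᵐ Ioo 0 T' ⊆ Ioo 0 T`. [cite: Tao2011, Thm. 5.4 (ii)] -/
theorem lintegral_Icc_sqrt_energy_le_lintegral_Ioo_sqrt_eH1NormSq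
    (f : ℝ → EuclideanSpace ℝ (Fin 3) → EuclideanSpace ℝ (Fin 3)) {T T' : ℝ} (hT' : T' ≤ T) :
    ∫⁻ t in Icc 0 T', (∫⁻ x, ‖f t x‖ₑ ^ 2) ^ (1 / 2 : ℝ) ≤
      ∫⁻ t in Ioo 0 T, eH1NormSq (f t) ^ (2⁻¹ : ℝ) := by
  rw [setLIntegral_congr (Ioo_ae_eq_Icc (μ := volume) (a := (0 : ℝ)) (b := T')).symm]
  refine (lintegral_mono_set (Ioo_subset_Ioo le_rfl hT')).trans (lintegral_mono fun t => ?_)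
  rw [one_div]
  refine ENNReal.rpow_le_rpow ?_ (by norm_num)
  rw [eH1NormSq_def]
  exact le_self_add

/-- The `L¹_t H¹_x` budget of the shifted force `t ↦ f (t + s)` on `[0, T - s]` is at most the budget
of `f` on `[0, T]` (`0 ≤ s`): `∫₀^{T-s} ‖f(t + s)‖_{H¹} dt = ∫ₛᵀ ‖f‖_{H¹} ≤ ∫₀ᵀ ‖f‖_{H¹}` (translation
invariance of Lebesgue measure, `setLIntegral_Ioo_comp_add_right`). This is the force clause of the
restarted problem in the proof of Tao 2013, Thm. 5.4. [cite: Tao2011, Thm. 5.4 (proof, restart at time `s`)] -/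
theorem lintegral_Ioo_sqrt_eH1NormSq_timeShift_le
    (f : ℝ → EuclideanSpace ℝ (Fin 3) → EuclideanSpace ℝ (Fin 3)) {T s : ℝ} (hs : 0 ≤ s) :
    ∫⁻ t in Ioo 0 (T - s), eH1NormSq (f (t + s)) ^ (2⁻¹ : ℝ) ≤
      ∫⁻ t in Ioo 0 T, eH1NormSq (f t) ^ (2⁻¹ : ℝ) := by
  rw [setLIntegral_Ioo_comp_add_right (fun t => eH1NormSq (f t) ^ (2⁻¹ : ℝ)) 0 (T - s) s,
    zero_add, sub_add_cancel]
  exact lintegral_mono_set (Ioo_subset_Ioo hs le_rfl)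

/-- Budget form: `∫⁻_{Ioo 0 T} ‖f‖_{H¹} ≤ B` implies `∫⁻_{Ioo 0 (T - s)} ‖f(· + s)‖_{H¹} ≤ B` (`0 ≤ s`).
[cite: Tao2011, Thm. 5.4 (proof, restart at time `s`)] -/
theorem lintegral_Ioo_sqrt_eH1NormSq_timeShift_le_of_le
    (f : ℝ → EuclideanSpace ℝ (Fin 3) → EuclideanSpace ℝ (Fin 3)) {T s : ℝ} (hs : 0 ≤ s) {b : ℝ≥0∞}
    (hBf : ∫⁻ t in Ioo 0 T, eH1NormSq (f t) ^ (2⁻¹ : ℝ) ≤ b) :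
    ∫⁻ t in Ioo 0 (T - s), eH1NormSq (f (t + s)) ^ (2⁻¹ : ℝ) ≤ b :=
  (lintegral_Ioo_sqrt_eH1NormSq_timeShift_le f hs).trans hBf

/-! ### Slab-Schwartz forces: `t ↦ ∫ |∇f(t)|²` -/

/-- For a force jointly smooth on the slab `[0, T] × ℝ³` with Tao's uniform Schwartz bounds there
(`T > 0`), the slice gradient energy `t ↦ ∫ |∇f(t)|² dx` is continuous on `[0, T]` (the enstrophy
balance `IsSmoothSpaceTimeOn.enstrophy_balance` applied to `f` itself, whose `Ḣ¹` bounds on `f` and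
`∂ₜf` come from `HasUniformRapidDecayOn.hasBoundedSobolevNormsOn_Icc`). [cite: Tao2011, §5 (proof of Thm. 5.4)] -/
theorem HasUniformRapidDecayOn.continuousOn_integral_frobeniusNormSq_fderiv
    (hfD : HasUniformRapidDecayOn (Icc 0 T) f) (hfS : IsSmoothSpaceTimeOn (Icc 0 T) f) (hT : 0 < T) :
    ContinuousOn (fun t => ∫ x, frobeniusNormSq (fderiv ℝ (f t) x)) (Icc 0 T) := by
  obtain ⟨hfB, hfB'⟩ := hfD.hasBoundedSobolevNormsOn_Icc hfS hT
  obtain ⟨F₁, hF₁⟩ := hfB 1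
  obtain ⟨F₁', hF₁'⟩ := hfB' 1
  obtain ⟨-, hGfc, -⟩ := hfS.enstrophy_balance hT hF₁ hF₁'
  exact hGfc

/-- For a slab-Schwartz force (`T > 0`), at every `t ∈ [0, T]` the slice gradient energy is finite and
its Bochner and lower integrals agree: `ofReal (∫ |∇f(t)|²) = ∫⁻ ofReal |∇f(t)|²`.
[cite: Tao2011, §5 (proof of Thm. 5.4)] -/
theorem HasUniformRapidDecayOn.ofReal_integral_frobeniusNormSq_fderiv_eq
    (hfD : HasUniformRapidDecayOn (Icc 0 T) f) (hfS : IsSmoothSpaceTimeOn (Icc 0 T) f) (hT : 0 < T)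
    {t : ℝ} (ht : t ∈ Icc 0 T) :
    ENNReal.ofReal (∫ x, frobeniusNormSq (fderiv ℝ (f t) x)) =
      ∫⁻ x, ENNReal.ofReal (frobeniusNormSq (fderiv ℝ (f t) x)) := by
  obtain ⟨hfB, -⟩ := hfD.hasBoundedSobolevNormsOn_Icc hfS hT
  obtain ⟨F₁, hF₁⟩ := hfB 1
  have hf1 : ContDiff ℝ 1 (f t) := (hfS.contDiff_slice ht).of_le (by norm_cast)
  have n1 : ∀ x, ‖fderiv ℝ (f t) x‖ = ‖iteratedFDeriv ℝ 1 (f t) x‖ := fun x => by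
    rw [← norm_iteratedFDeriv_fderiv, norm_iteratedFDeriv_zero]
  have hDf : ∫⁻ x, ‖fderiv ℝ (f t) x‖ₑ ^ 2 < ⊤ :=
    lintegral_enorm_sq_lt_top_of_norm_le (fun x => (n1 x).le)
      ((hF₁ t ht).trans_lt ENNReal.coe_lt_top)
  have hlt : ∫⁻ x, ENNReal.ofReal (frobeniusNormSq (fderiv ℝ (f t) x)) < ⊤ :=
    calc ∫⁻ x, ENNReal.ofReal (frobeniusNormSq (fderiv ℝ (f t) x))
        ≤ ∫⁻ x, 3 * ‖fderiv ℝ (f t) x‖ₑ ^ 2 :=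
          lintegral_mono fun x => ofReal_frobeniusNormSq_le_three_mul_enorm_sq _
      _ = 3 * ∫⁻ x, ‖fderiv ℝ (f t) x‖ₑ ^ 2 := lintegral_const_mul' _ _ (by norm_num)
      _ < ⊤ := ENNReal.mul_lt_top (by norm_num) hDf
  have hint : Integrable (fun x => frobeniusNormSq (fderiv ℝ (f t) x)) volume :=
    integrable_of_continuous_of_nonneg (continuous_frobeniusNormSq_fderiv hf1 one_ne_zero)
      (fun x => frobeniusNormSq_nonneg _) hlt
  exact ofReal_integral_eq_lintegral_ofReal hint
    (Eventually.of_forall fun x => frobeniusNormSq_nonneg _)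

/-! ### The enstrophy-bound currency `∫₀^{T'} ‖∇f(t)‖₂ dt ≤ B` -/

/-- `∫₀^{T'} ‖∇f(t)‖_{L²} dt ≤ B` (real interval integral, `0 < T' ≤ T`) from the `ℝ≥0∞` budget
`∫₀ᵀ ‖f(t)‖_{H¹} dt ≤ B`, for any force with `C¹` slices on `[0, T]` whose slice gradient energy
`t ↦ ∫ |∇f(t)|²` is continuous on `[0, T]` with Bochner = lower integral (`‖∇v‖₂ ≤ ‖v‖_{H¹}`).
[cite: Tao2011, Thm. 5.4 (ii)] -/
theorem integral_sqrt_frobeniusNormSq_fderiv_le_of_continuousOn {T' B : ℝ} (hT'0 : 0 < T')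
    (hT' : T' ≤ T) (hB : 0 ≤ B)
    (hf1 : ∀ t ∈ Icc 0 T, ContDiff ℝ 1 (f t))
    (hGfc : ContinuousOn (fun t => ∫ x, frobeniusNormSq (fderiv ℝ (f t) x)) (Icc 0 T))
    (hGfeq : ∀ t ∈ Icc 0 T, ENNReal.ofReal (∫ x, frobeniusNormSq (fderiv ℝ (f t) x)) =
      ∫⁻ x, ENNReal.ofReal (frobeniusNormSq (fderiv ℝ (f t) x)))
    (hBf : ∫⁻ t in Ioo 0 T, eH1NormSq (f t) ^ (2⁻¹ : ℝ) ≤ ENNReal.ofReal B) :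
    ∫ t in (0 : ℝ)..T', Real.sqrt (∫ x, frobeniusNormSq (fderiv ℝ (f t) x)) ≤ B := by
  obtain ⟨g, hg⟩ : ∃ g : ℝ → ℝ,
      g = fun t => Real.sqrt (∫ x, frobeniusNormSq (fderiv ℝ (f t) x)) := ⟨_, rfl⟩
  have hgt : ∀ t, g t = Real.sqrt (∫ x, frobeniusNormSq (fderiv ℝ (f t) x)) := fun t => by rw [hg]
  have hgc : ContinuousOn g (Icc 0 T) := by
    rw [hg]; exact Real.continuous_sqrt.comp_continuousOn hGfc
  have hg0 : ∀ t, 0 ≤ g t := fun t => by rw [hgt]; exact Real.sqrt_nonneg _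
  -- pointwise: `ofReal (g t) ≤ ‖f(t)‖_{H¹}`
  have hpt : ∀ t ∈ Icc 0 T, ENNReal.ofReal (g t) ≤ eH1NormSq (f t) ^ (2⁻¹ : ℝ) := by
    intro t ht
    have h1 : ENNReal.ofReal (g t) =
        (∫⁻ x, ENNReal.ofReal (frobeniusNormSq (fderiv ℝ (f t) x))) ^ (2⁻¹ : ℝ) := by
      rw [hgt, Real.sqrt_eq_rpow, ← ENNReal.ofReal_rpow_of_nonneg
        (integral_nonneg fun _ => frobeniusNormSq_nonneg _) (by norm_num), hGfeq t ht, one_div]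
    rw [h1, ← eWeakGradL2Sq_eq_of_hasWeakGradient (hasWeakGradient_fderiv_of_contDiff (hf1 t ht)),
      eH1NormSq_def]
    exact ENNReal.rpow_le_rpow le_add_self (by norm_num)
  simp only [← hgt]
  rw [intervalIntegral.integral_of_le hT'0.le]
  have hmeas : AEStronglyMeasurable g (volume.restrict (Ioc 0 T')) :=
    (hgc.mono (Ioc_subset_Icc_self.trans (Icc_subset_Icc_right hT'))).aestronglyMeasurable
      measurableSet_Ioc
  rw [integral_eq_lintegral_of_nonneg_ae (Eventually.of_forall hg0) hmeas]
  refine ENNReal.toReal_le_of_le_ofReal hB ?_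
  calc ∫⁻ t in Ioc 0 T', ENNReal.ofReal (g t)
      ≤ ∫⁻ t in Ioc 0 T', eH1NormSq (f t) ^ (2⁻¹ : ℝ) :=
        setLIntegral_mono' measurableSet_Ioc fun t ht => hpt t ⟨ht.1.le, ht.2.trans hT'⟩
    _ = ∫⁻ t in Ioo 0 T', eH1NormSq (f t) ^ (2⁻¹ : ℝ) :=
        setLIntegral_congr (Ioo_ae_eq_Ioc (μ := volume) (a := (0 : ℝ)) (b := T')).symm
    _ ≤ ∫⁻ t in Ioo 0 T, eH1NormSq (f t) ^ (2⁻¹ : ℝ) := lintegral_mono_set (Ioo_subset_Ioo le_rfl hT')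
    _ ≤ ENNReal.ofReal B := hBf

/-- **Slab-Schwartz force: `∫₀^{T'} ‖∇f(t)‖₂ dt ≤ B`** (real interval integral, `0 < T' ≤ T`) from the
`L¹_t H¹_x` budget `∫⁻_{Ioo 0 T} ‖f(t)‖_{H¹} ≤ B` of Tao 2013, Thm. 5.4 (ii) — the force hypothesis of
the enstrophy a priori bound `exists_leray_enstrophy_apriori_forced`. [cite: Tao2011, Thm. 5.4 (ii)] -/
theorem HasUniformRapidDecayOn.integral_sqrt_frobeniusNormSq_fderiv_le
    (hfD : HasUniformRapidDecayOn (Icc 0 T) f) (hfS : IsSmoothSpaceTimeOn (Icc 0 T) f) (hT : 0 < T)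
    {T' B : ℝ} (hT'0 : 0 < T') (hT' : T' ≤ T) (hB : 0 ≤ B)
    (hBf : ∫⁻ t in Ioo 0 T, eH1NormSq (f t) ^ (2⁻¹ : ℝ) ≤ ENNReal.ofReal B) :
    ∫ t in (0 : ℝ)..T', Real.sqrt (∫ x, frobeniusNormSq (fderiv ℝ (f t) x)) ≤ B :=
  integral_sqrt_frobeniusNormSq_fderiv_le_of_continuousOn hT'0 hT' hB
    (fun _ ht => (hfS.contDiff_slice ht).of_le (by norm_cast))
    (hfD.continuousOn_integral_frobeniusNormSq_fderiv hfS hT)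
    (fun _ ht => hfD.ofReal_integral_frobeniusNormSq_fderiv_eq hfS hT ht) hBf

/-! ### Clay-class forces -/

/-- **Clay-class force: `∫₀^{T'} ‖∇f(t)‖₂ dt ≤ B`** (`0 < T' ≤ T`) from the `L¹_t H¹_x` budget
`∫⁻_{Ioo 0 T} ‖f(t)‖_{H¹} ≤ B`, for `f` smooth on `[0, ∞) × ℝ³` with Fefferman's decay (5) (which is
slab-Schwartz on `[0, T]`: `IsSmoothOnHalfSpace.isSmoothSpaceTimeOn_Icc`,
`HasRapidSpaceTimeDecay.hasUniformRapidDecayOn_Icc`). [cite: Tao2011, Thm. 5.4 (ii)]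
[cite: FeffermanClay2006, (5)-(6)] -/
theorem clayForce_integral_sqrt_frobeniusNormSq_fderiv_le (hfs : IsSmoothOnHalfSpace f)
    (hfd : HasRapidSpaceTimeDecay f) {T' B : ℝ} (hT'0 : 0 < T') (hT' : T' ≤ T) (hB : 0 ≤ B)
    (hBf : ∫⁻ t in Ioo 0 T, eH1NormSq (f t) ^ (2⁻¹ : ℝ) ≤ ENNReal.ofReal B) :
    ∫ t in (0 : ℝ)..T', Real.sqrt (∫ x, frobeniusNormSq (fderiv ℝ (f t) x)) ≤ B :=
  have hT : 0 < T := hT'0.trans_le hT'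
  (hfd.hasUniformRapidDecayOn_Icc hfs hT).integral_sqrt_frobeniusNormSq_fderiv_le
    (hfs.isSmoothSpaceTimeOn_Icc T) hT hT'0 hT' hB hBf

/-- **Clay-class force: the energy-bound currency** `∫⁻_{Icc 0 T'} (∫⁻ ‖f t‖ₑ²)^{1/2} ≤ B` (`T' ≤ T`)
from the budget `∫⁻_{Ioo 0 T} ‖f(t)‖_{H¹} ≤ B` (holds for any `f`; named for the assembly).
[cite: Tao2011, Thm. 5.4 (ii)] -/
theorem lintegral_Icc_sqrt_energy_le_of_le
    (f : ℝ → EuclideanSpace ℝ (Fin 3) → EuclideanSpace ℝ (Fin 3)) {T T' : ℝ} (hT' : T' ≤ T)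
    {b : ℝ≥0∞} (hBf : ∫⁻ t in Ioo 0 T, eH1NormSq (f t) ^ (2⁻¹ : ℝ) ≤ b) :
    ∫⁻ t in Icc 0 T', (∫⁻ x, ‖f t x‖ₑ ^ 2) ^ (1 / 2 : ℝ) ≤ b :=
  (lintegral_Icc_sqrt_energy_le_lintegral_Ioo_sqrt_eH1NormSq f hT').trans hBf

/-- **Clay-class force, shifted: `∫₀^{T'} ‖∇f(t + s)‖₂ dt ≤ B`** (`0 ≤ s`, `0 < T' ≤ T - s`) from the
budget of `f` on `[0, T]` — the enstrophy-bound force clause of the restarted problem at time `s`.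
[cite: Tao2011, Thm. 5.4 (proof, restart at time `s`)] [cite: FeffermanClay2006, (5)-(6)] -/
theorem clayForce_integral_sqrt_frobeniusNormSq_fderiv_timeShift_le (hfs : IsSmoothOnHalfSpace f)
    (hfd : HasRapidSpaceTimeDecay f) {s T' B : ℝ} (hs : 0 ≤ s) (hT'0 : 0 < T') (hT' : T' ≤ T - s)
    (hB : 0 ≤ B) (hBf : ∫⁻ t in Ioo 0 T, eH1NormSq (f t) ^ (2⁻¹ : ℝ) ≤ ENNReal.ofReal B) :
    ∫ t in (0 : ℝ)..T', Real.sqrt (∫ x, frobeniusNormSq (fderiv ℝ (f (t + s)) x)) ≤ B :=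
  clayForce_integral_sqrt_frobeniusNormSq_fderiv_le (f := fun t => f (t + s)) (hfs.timeShift hs)
    (hfd.timeShift hfs hs) hT'0 hT' hB (lintegral_Ioo_sqrt_eH1NormSq_timeShift_le_of_le f hs hBf)

end Literature.Analysis.FluidPDE

end
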